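import Literature.Computability.QuantumComplexity.AKSMachineArith
import Literature.Computability.Complexity.ListFoldBricks
import HarnessLib

/-!
# The AKS machine, II: powers in `ℤ_n[X]/(X^r - 1)` and the test of step 5 as `FP` functions

Continuation of `AKSMachineArith.lean` (`cmulFn`, the product on coded coefficient lists, context
`ctx = ⟨pad, ⟨bin n, bin r⟩⟩`). Here:

* `tabFn cnt piece` — tabulating a coded list `natList [f 0, …, f (m-1)]` from a piece function
  `⟨Y, 1ᵏ⟩ ↦ ⟨bin (f k), ε⟩` (an `appF`-fold, as `cmulFn`), with `tabFn_apply`/`tabFn_mem_FP`; the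
  instances `coneFn`, `xPlusAFn`, `xnPlusAFn` computing the lists `AKS.cone n r`, `AKS.xPlusA n r a`,
  `AKS.xnPlusA n r a` of `AKSPolyArith.lean` from `⟨ctx, bin a⟩`;
* `powBody`, **`cpowFn`** — square-and-multiply (`AKS.cpowAux`, `Nat.size e` rounds of the clocked
  loop `ListBricks.loopX` with a clipped body): `cpowFn ⟨ctx, ⟨natList u, bin e⟩⟩ = natList (AKS.cpow n r u e)`
  (`cpowFn_apply`, for canonical `u`, `2 ≤ n`, `|bin e| ≤ |ctx|` and padding `|pad| ≥ r (|bin n| + 1)`,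
  which makes every genuine intermediate state at most `5 (|ctx| + 1)` symbols long so that the clip
  never bites), `cpowFn_mem_FP`;
* **`congrFn`** — the test of step 5 of [AKS04] for one `a`:
  `congrFn ⟨ctx, bin a⟩ = [AKS.congrTest n r a]` (`congrFn_apply`), `congrFn_mem_FP`, `oneBit_congrFn`.

## References

* [AKS04] M. Agrawal, N. Kayal, N. Saxena, *PRIMES is in P*, Ann. of Math. 160 (2004) 781–793,
  §4 step 5, §5 (proof of Thm 5.1).
* S. Arora, B. Barak, *Computational Complexity: A Modern Approach*, CUP 2009, §1.3.
-/

namespace Literature.Computability.QuantumComplexity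

open _root_.Computability Complexity Complexity.Brick Polynomial
open Literature.NumberTheory.Primality

namespace AKSMachine

/-! ### Tabulating a list from a piece function -/

/-- **Tabulation**: from `Y`, with `cnt Y = bin m`, the `appF`-fold of the clipped pieces
`piece ⟨Y, 1ᵏ⟩`, `k < m` (each a one-item code `⟨bin (f k), ε⟩`), i.e. the code `natList [f 0, …, f (m-1)]`.
[cite: AroraBarakCC2009, §1.3 (bounded loops)] -/
noncomputable def tabFn (cnt piece : List Bool → List Bool) : List Bool → List Bool :=
  sndPow 2 ∘ foldLoop appF (clipF 2 piece) X ∘ fanoutFn id (fanoutFn cnt fun _ => boolPair [] [])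

/-- `tabFn cnt piece ∈ FP`. [folklore] -/
theorem tabFn_mem_FP {cnt piece : List Bool → List Bool} (hcnt : cnt ∈ FP) (hp : piece ∈ FP) : tabFn cnt piece ∈ FP :=
  comp_mem_FP (sndPow_mem_FP 2) (comp_mem_FP (foldLoop_clipF_mem_FP 2 appF_mem_FP length_appF_le hp X)
    (fanoutFn_mem_FP OracleCompose.id_mem_FP (fanoutFn_mem_FP hcnt (const_mem_FP _))))

/-- `(List.range |l|).map (l[·]) = l`. [folklore] -/
theorem map_getD_range (l : List ℕ) : (List.range l.length).map (fun k => l.getD k 0) = l := by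
  refine List.ext_getElem (by simp) fun i h₁ h₂ => ?_
  rw [List.getElem_map, List.getElem_range, List.getD_eq_getElem _ _ h₂]

/-- **Value of a tabulation**: if `cnt Y = bin m`, `m ≤ |Y|`, and for `k < m` the piece is the one-item
code of `bin (f k)` with `|bin (f k)| ≤ |Y|`, then `tabFn cnt piece Y = natList [f 0, …, f (m-1)]`. [folklore] -/
theorem tabFn_apply {cnt piece : List Bool → List Bool} {Y : List Bool} {m : ℕ} (hcnt : cnt Y = encodeNat m)
    (hm : m ≤ Y.length) (f : ℕ → ℕ) (hpiece : ∀ k < m, piece (boolPair Y (ones k)) = boolPair (encodeNat (f k)) [])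
    (hshort : ∀ k < m, (encodeNat (f k)).length ≤ Y.length) :
    tabFn cnt piece Y = natList ((List.range m).map f) := by
  have hinit : fanoutFn id (fanoutFn cnt fun _ => boolPair [] []) Y = boolPair Y (boolPair (encodeNat m) (boolPair (ones 0) [])) := by
    rw [show (ones 0 : List Bool) = [] from rfl]; simp [hcnt]
  rw [tabFn, Function.comp_apply, Function.comp_apply, hinit, foldLoop_apply appF _ (by rw [eval_X]; exact hm) 0 [],
    show sndPow 2 = sndF ∘ sndF ∘ sndF from rfl]
  simp only [Function.comp_apply, sndF_boolPair]
  rw [foldAcc_clipF (fun j _ hj => by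
      rw [hpiece j (by omega), length_boolPair, List.length_nil]
      have := hshort j (by omega); omega),
    foldAcc_appF, List.nil_append, natList_eq_ccat, List.length_map, List.length_range]
  refine ccat_congr fun k hk => ?_
  rw [zero_add, hpiece k hk, List.getD_eq_getElem _ _ (by simpa using hk)]
  simp

/-! ### The coefficient lists `1`, `X + a`, `X ^ n + a` -/

/-- On `⟨⟨ctx, bin a⟩, 1ᵏ⟩`: the context. [folklore] -/
noncomputable def tCtx : List Bool → List Bool := fstF ∘ fstF
/-- On `⟨⟨ctx, bin a⟩, 1ᵏ⟩`: `bin a`. [folklore] -/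
noncomputable def tA : List Bool → List Bool := sndF ∘ fstF
/-- On `⟨⟨ctx, bin a⟩, 1ᵏ⟩`: `bin k`. [folklore] -/
noncomputable def tK : List Bool → List Bool := lenBinF ∘ sndF

/-- `tCtx` is in `FP` (composition of bricks). [folklore] -/
theorem tCtx_mem_FP : tCtx ∈ FP := comp_mem_FP fstF_mem_FP fstF_mem_FP
/-- `tA` is in `FP` (composition of bricks). [folklore] -/
theorem tA_mem_FP : tA ∈ FP := comp_mem_FP sndF_mem_FP fstF_mem_FP
/-- `tK` is in `FP` (composition of bricks). [folklore] -/
theorem tK_mem_FP : tK ∈ FP := comp_mem_FP lenBinF_mem_FP sndF_mem_FP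

/-- The numeral `bin (if k = c then 1 else 0)` for a computed `bin c`: `⟨⟨ctx, bin a⟩, 1ᵏ⟩ ↦ …`. [folklore] -/
noncomputable def indF (c : List Bool → List Bool) : List Bool → List Bool :=
  iteFn (eqValFn ∘ fanoutFn tK c) (fun _ => encodeNat 1) fun _ => []

/-- `indF` is in `FP` (composition of bricks). [folklore] -/
theorem indF_mem_FP {c : List Bool → List Bool} (hc : c ∈ FP) : indF c ∈ FP :=
  iteFn_mem_FP (comp_mem_FP eqValFn_mem_FP (fanoutFn_mem_FP tK_mem_FP hc)) (const_mem_FP _) (const_mem_FP _)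

/-- Value of `indF`: with `⟦c ⟨Y, 1ᵏ⟩⟧ = m`, it is `bin 1` if `k = m` and `ε = bin 0` otherwise. [folklore] -/
theorem indF_apply (c : List Bool → List Bool) (Y : List Bool) (k m : ℕ) (hc : bitsToNat (c (boolPair Y (ones k))) = m) :
    indF c (boolPair Y (ones k)) = if k = m then encodeNat 1 else [] := by
  rw [indF, iteFn_apply (b := decide (k = m)) (by simp [tK, hc])]
  by_cases h : k = m
  · simp [h]
  · simp [h]

/-- The value of `indF` as a number: `[k = m]`. [folklore] -/
theorem bitsToNat_indF (c : List Bool → List Bool) (Y : List Bool) (k m : ℕ) (hc : bitsToNat (c (boolPair Y (ones k))) = m) :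
    bitsToNat (indF c (boolPair Y (ones k))) = if k = m then 1 else 0 := by
  rw [indF_apply c Y k m hc]
  split_ifs <;> simp

/-- The summand `bin (if k = 0 then a else 0)`. [folklore] -/
noncomputable def aIfZeroF : List Bool → List Bool :=
  iteFn (isNilFn ∘ sndF) tA fun _ => []

/-- `aIfZeroF` is in `FP` (composition of bricks). [folklore] -/
theorem aIfZeroF_mem_FP : aIfZeroF ∈ FP :=
  iteFn_mem_FP (comp_mem_FP isNilFn_mem_FP sndF_mem_FP) tA_mem_FP (const_mem_FP _)

/-- Value of `aIfZeroF` on `⟨⟨ctx, bin a⟩, 1ᵏ⟩`. [folklore] -/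
theorem aIfZeroF_apply (ctx : List Bool) (a k : ℕ) :
    aIfZeroF (boolPair (boolPair ctx (encodeNat a)) (ones k)) = encodeNat (if k = 0 then a else 0) := by
  rw [aIfZeroF, iteFn_apply (b := decide (k = 0)) (by cases k <;> simp [isNilFn, ones, List.replicate_succ])]
  cases k with
  | zero => simp [tA]
  | succ k => simp; rfl

/-- The generic piece of the three lists: `⟨bin ((⟦ind⟧ + ⟦aIfZeroF⟧) mod n), ε⟩`. [folklore] -/
noncomputable def listPiece (ind : List Bool → List Bool) : List Bool → List Bool :=
  fanoutFn (remFn ∘ fanoutFn (addFn ∘ fanoutFn ind aIfZeroF) (cN ∘ tCtx)) fun _ => []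

/-- `listPiece` is in `FP` (composition of bricks). [folklore] -/
theorem listPiece_mem_FP {ind : List Bool → List Bool} (h : ind ∈ FP) : listPiece ind ∈ FP :=
  fanoutFn_mem_FP (comp_mem_FP remFn_mem_FP (fanoutFn_mem_FP (comp_mem_FP addFn_mem_FP (fanoutFn_mem_FP h aIfZeroF_mem_FP))
    (comp_mem_FP cN_mem_FP tCtx_mem_FP))) (const_mem_FP _)

/-- Value of `listPiece` on `⟨⟨pctx pad n r, bin a⟩, 1ᵏ⟩`. [folklore] -/
theorem listPiece_apply (ind : List Bool → List Bool) (pad : List Bool) (n r a k : ℕ) :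
    listPiece ind (boolPair (boolPair (pctx pad n r) (encodeNat a)) (ones k)) =
      boolPair (encodeNat ((bitsToNat (ind (boolPair (boolPair (pctx pad n r) (encodeNat a)) (ones k))) +
        (if k = 0 then a else 0)) % n)) [] := by
  simp only [listPiece, fanoutFn_apply, Function.comp_apply, aIfZeroF_apply, addFn_boolPair, bitsToNat_encodeNat,
    tCtx, fstF_boolPair, cN_pctx, remFn_boolPair]

/-- **The list of `1`**: `⟨ctx, bin a⟩ ↦ natList (cone n r)` (the `a` field is ignored).
[cite: AgrawalKayalSaxena2004, §4 (step 5)] -/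
noncomputable def coneFn : List Bool → List Bool :=
  tabFn (cR ∘ fstF) (fanoutFn (remFn ∘ fanoutFn (indF fun _ => []) (cN ∘ tCtx)) fun _ => [])

/-- **The list of `X + a`**: `⟨ctx, bin a⟩ ↦ natList (xPlusA n r a)`. [cite: AgrawalKayalSaxena2004, §4 (step 5)] -/
noncomputable def xPlusAFn : List Bool → List Bool :=
  tabFn (cR ∘ fstF) (listPiece (indF fun _ => encodeNat 1))

/-- **The list of `X ^ n + a`** reduced: `⟨ctx, bin a⟩ ↦ natList (xnPlusA n r a)`. [cite: AgrawalKayalSaxena2004, §4 (step 5)] -/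
noncomputable def xnPlusAFn : List Bool → List Bool :=
  tabFn (cR ∘ fstF) (listPiece (indF (remFn ∘ fanoutFn (cN ∘ tCtx) (cR ∘ tCtx))))

/-- `coneFn` is in `FP` (composition of bricks). [folklore] -/
theorem coneFn_mem_FP : coneFn ∈ FP :=
  tabFn_mem_FP (comp_mem_FP cR_mem_FP fstF_mem_FP) (fanoutFn_mem_FP (comp_mem_FP remFn_mem_FP
    (fanoutFn_mem_FP (indF_mem_FP (const_mem_FP _)) (comp_mem_FP cN_mem_FP tCtx_mem_FP))) (const_mem_FP _))

/-- `xPlusAFn` is in `FP` (composition of bricks). [folklore] -/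
theorem xPlusAFn_mem_FP : xPlusAFn ∈ FP :=
  tabFn_mem_FP (comp_mem_FP cR_mem_FP fstF_mem_FP) (listPiece_mem_FP (indF_mem_FP (const_mem_FP _)))

/-- `xnPlusAFn` is in `FP` (composition of bricks). [folklore] -/
theorem xnPlusAFn_mem_FP : xnPlusAFn ∈ FP :=
  tabFn_mem_FP (comp_mem_FP cR_mem_FP fstF_mem_FP) (listPiece_mem_FP (indF_mem_FP
    (comp_mem_FP remFn_mem_FP (fanoutFn_mem_FP (comp_mem_FP cN_mem_FP tCtx_mem_FP) (comp_mem_FP cR_mem_FP tCtx_mem_FP)))))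

/-- A residue `mod n` has a numeral no longer than the context (`0 < n`). [folklore] -/
theorem length_encodeNat_mod_le (pad : List Bool) {n : ℕ} (hn : 0 < n) (r x : ℕ) :
    (encodeNat (x % n)).length ≤ (pctx pad n r).length := by
  have := length_encodeNat_mono (Nat.mod_lt x hn).le
  rw [length_pctx]; omega

/-- **`coneFn` computes `AKS.cone`** (`0 < n`, `r ≤ |ctx|`). [folklore] -/
theorem coneFn_apply (pad : List Bool) {n r : ℕ} (hn : 0 < n) (hr : r ≤ (pctx pad n r).length) (a : ℕ) :
    coneFn (boolPair (pctx pad n r) (encodeNat a)) = natList (AKS.cone n r) := by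
  rw [coneFn, AKS.cone, tabFn_apply (m := r) (by simp) (by rw [length_boolPair]; omega) (fun k => (if k = 0 then 1 else 0) % n)]
  · intro k _
    rw [fanoutFn_apply, Function.comp_apply, fanoutFn_apply, remFn_boolPair, bitsToNat_indF _ _ _ 0 (by simp)]
    simp [tCtx]
  · intro k _
    exact (length_encodeNat_mod_le pad hn r _).trans (by rw [length_boolPair]; omega)

/-- **`xPlusAFn` computes `AKS.xPlusA`** (`0 < n`, `r ≤ |ctx|`). [folklore] -/
theorem xPlusAFn_apply (pad : List Bool) {n r : ℕ} (hn : 0 < n) (hr : r ≤ (pctx pad n r).length) (a : ℕ) :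
    xPlusAFn (boolPair (pctx pad n r) (encodeNat a)) = natList (AKS.xPlusA n r a) := by
  rw [xPlusAFn, AKS.xPlusA, tabFn_apply (m := r) (by simp) (by rw [length_boolPair]; omega)
    (fun k => ((if k = 1 then 1 else 0) + if k = 0 then a else 0) % n)]
  · intro k _
    rw [listPiece_apply, bitsToNat_indF _ _ _ 1 (by simp)]
  · intro k _
    exact (length_encodeNat_mod_le pad hn r _).trans (by rw [length_boolPair]; omega)

/-- **`xnPlusAFn` computes `AKS.xnPlusA`** (`0 < n`, `r ≤ |ctx|`). [folklore] -/
theorem xnPlusAFn_apply (pad : List Bool) {n r : ℕ} (hn : 0 < n) (hr : r ≤ (pctx pad n r).length) (a : ℕ) :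
    xnPlusAFn (boolPair (pctx pad n r) (encodeNat a)) = natList (AKS.xnPlusA n r a) := by
  rw [xnPlusAFn, AKS.xnPlusA, tabFn_apply (m := r) (by simp) (by rw [length_boolPair]; omega)
    (fun k => ((if k = n % r then 1 else 0) + if k = 0 then a else 0) % n)]
  · intro k _
    rw [listPiece_apply, bitsToNat_indF _ _ _ (n % r) (by simp [tCtx])]
  · intro k _
    exact (length_encodeNat_mod_le pad hn r _).trans (by rw [length_boolPair]; omega)

/-! ### Square-and-multiply -/

/-- The coded state `⟨natList res, ⟨natList base, bin e⟩⟩` of the power loop. [folklore] -/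
def pstate (res base : List ℕ) (e : ℕ) : List Bool := boolPair (natList res) (boolPair (natList base) (encodeNat e))

/-- **One round of square-and-multiply** on the loop record `⟨ctx, ⟨cnt, ⟨res, ⟨base, e⟩⟩⟩⟩`:
`res := res ⋆ base` if `e` is odd, `base := base ⋆ base`, `e := ⌊e / 2⌋`.
[cite: AgrawalKayalSaxena2004, §5 (repeated squaring)] -/
noncomputable def powBody : List Bool → List Bool :=
  fanoutFn (iteFn (parityFn ∘ sndPow 3) (nthF 2) (cmulFn ∘ fanoutFn (nthF 0) (fanoutFn (nthF 2) (nthF 3))))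
    (fanoutFn (cmulFn ∘ fanoutFn (nthF 0) (fanoutFn (nthF 3) (nthF 3)))
      (divFn ∘ fanoutFn (sndPow 3) fun _ => encodeNat 2))

/-- `powBody ∈ FP`. [folklore] -/
theorem powBody_mem_FP : powBody ∈ FP :=
  fanoutFn_mem_FP
    (iteFn_mem_FP (comp_mem_FP parityFn_mem_FP (sndPow_mem_FP 3)) (nthF_mem_FP 2)
      (comp_mem_FP cmulFn_mem_FP (fanoutFn_mem_FP (nthF_mem_FP 0) (fanoutFn_mem_FP (nthF_mem_FP 2) (nthF_mem_FP 3)))))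
    (fanoutFn_mem_FP (comp_mem_FP cmulFn_mem_FP (fanoutFn_mem_FP (nthF_mem_FP 0) (fanoutFn_mem_FP (nthF_mem_FP 3) (nthF_mem_FP 3))))
      (comp_mem_FP divFn_mem_FP (fanoutFn_mem_FP (sndPow_mem_FP 3) (const_mem_FP _))))

/-- **Value of one round** on a genuine record (`0 < n`, `r ≤ |ctx|`). [folklore] -/
theorem powBody_apply (pad : List Bool) {n r : ℕ} (hn : 0 < n) (hr : r ≤ (pctx pad n r).length) (c : List Bool)
    (res base : List ℕ) (e : ℕ) :
    powBody (boolPair (pctx pad n r) (boolPair c (pstate res base e))) =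
      pstate (if e % 2 = 1 then AKS.cmul n r res base else res) (AKS.cmul n r base base) (e / 2) := by
  have hpar : (parityFn ∘ sndPow 3) (boolPair (pctx pad n r) (boolPair c (pstate res base e))) = [decide (Even e)] := by
    simp [parityFn, pstate, sndPow]
  rw [powBody, fanoutFn_apply, fanoutFn_apply, iteFn_apply hpar]
  simp only [pstate, Function.comp_apply, fanoutFn_apply, nthF_zero_boolPair, nthF_succ_boolPair,
    sndPow_succ_boolPair, sndPow_zero, sndF_boolPair, cmulFn_apply pad hn hr, divFn_boolPair, bitsToNat_encodeNat]
  by_cases he : e % 2 = 1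
  · have : ¬Even e := Nat.not_even_iff.mpr he
    simp [he, this]
  · have : Even e := Nat.even_iff.mpr (by omega)
    simp [he, this]

/-- The iterated squares of the base. [folklore] -/
def baseIter (n r : ℕ) : ℕ → List ℕ → List ℕ
  | 0, b => b
  | k + 1, b => baseIter n r k (AKS.cmul n r b b)

/-- `baseIter` keeps lists canonical. [folklore] -/
theorem canon_baseIter {n : ℕ} (hn : 0 < n) (r : ℕ) : ∀ (k : ℕ) {b : List ℕ}, AKS.Canon n r b → AKS.Canon n r (baseIter n r k b)
  | 0, _, h => h
  | k + 1, _, _ => canon_baseIter hn r k (AKS.canon_cmul hn r _ _)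

/-- **Size of a canonical coded list**: `|natList l| ≤ r (2 |bin n| + 2)`. [folklore] -/
theorem length_natList_canon {n r : ℕ} {l : List ℕ} (h : AKS.Canon n r l) :
    (natList l).length ≤ r * (2 * (encodeNat n).length + 2) := by
  rw [← h.1]
  refine length_natList_le (B := (encodeNat n).length) fun x hx => ?_
  have hx' := h.2 x hx
  calc x < n := hx'
    _ < 2 ^ (encodeNat n).length := by rw [TM2Pass.length_encodeNat_eq_size]; exact Nat.lt_size_self n

/-- **The clipped round agrees with the round on genuine states** when the padding dominates:
with `|pad| ≥ r (|bin n| + 1)` and `|bin e| ≤ |ctx|`, a genuine next state is `≤ 5 (|ctx| + 1)` long. [folklore] -/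
theorem length_powBody_apply_le (pad : List Bool) {n r : ℕ} (hn : 0 < n) (hpad : r * ((encodeNat n).length + 1) ≤ pad.length)
    (c : List Bool) {res : List ℕ} (base : List ℕ) (hres : AKS.Canon n r res) {e : ℕ}
    (he : (encodeNat e).length ≤ (pctx pad n r).length) :
    (powBody (boolPair (pctx pad n r) (boolPair c (pstate res base e)))).length ≤ 5 * ((pctx pad n r).length + 1) := by
  have hr : r ≤ (pctx pad n r).length := by rw [length_pctx]; nlinarith
  rw [powBody_apply pad hn hr, pstate, length_boolPair, length_boolPair]
  have h1 : (natList (if e % 2 = 1 then AKS.cmul n r res base else res)).length ≤ r * (2 * (encodeNat n).length + 2) := by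
    split_ifs
    · exact length_natList_canon (AKS.canon_cmul hn r _ _)
    · exact length_natList_canon hres
  have h2 := length_natList_canon (AKS.canon_cmul hn r base base)
  have h3 : (encodeNat (e / 2)).length ≤ (pctx pad n r).length := (length_encodeNat_mono (Nat.div_le_self e 2)).trans he
  have h4 : r * (2 * (encodeNat n).length + 2) = 2 * (r * ((encodeNat n).length + 1)) := by ring
  rw [length_pctx] at *
  omega

/-- **The model of the clipped power loop on genuine states is `AKS.cpowAux`.** [folklore] -/
theorem loopModel_powBody (pad : List Bool) {n r : ℕ} (hn : 0 < n) (hpad : r * ((encodeNat n).length + 1) ≤ pad.length) :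
    ∀ (k : ℕ) {res base : List ℕ} (e : ℕ), AKS.Canon n r res → AKS.Canon n r base →
      (encodeNat e).length ≤ (pctx pad n r).length →
      loopModel (clipF 5 powBody) (pctx pad n r) k (pstate res base e) =
        pstate (AKS.cpowAux n r k res base e) (baseIter n r k base) (e / 2 ^ k)
  | 0, res, base, e, _, _, _ => by simp [loopModel, AKS.cpowAux, baseIter]
  | k + 1, res, base, e, hres, _, he => by
    have hr : r ≤ (pctx pad n r).length := by rw [length_pctx]; nlinarith
    have hstep := clipF_eq_self (C := 5) (f := powBody)
      (z := boolPair (pctx pad n r) (boolPair (encodeNat (k + 1)) (pstate res base e)))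
      (by rw [fstF_boolPair]; exact length_powBody_apply_le pad hn hpad _ base hres he)
    have hres' : AKS.Canon n r (if e % 2 = 1 then AKS.cmul n r res base else res) := by
      split_ifs
      · exact AKS.canon_cmul hn r _ _
      · exact hres
    rw [loopModel, hstep, powBody_apply pad hn hr,
      loopModel_powBody pad hn hpad k (e / 2) hres' (AKS.canon_cmul hn r _ _)
        ((length_encodeNat_mono (Nat.div_le_self e 2)).trans he)]
    simp only [AKS.cpowAux, baseIter]
    rw [Nat.div_div_eq_div_mul, ← pow_succ']

/-- **The power function** `⟨ctx, ⟨u, bin e⟩⟩ ↦ natList (cpow n r ⟦u⟧ e)`: `|bin e| = size e` rounds of the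
clipped square-and-multiply loop from the state `⟨cone, ⟨u, bin e⟩⟩`.
[cite: AgrawalKayalSaxena2004, §5 (repeated squaring)] -/
noncomputable def cpowFn : List Bool → List Bool :=
  nthF 2 ∘ loopX (clipF 5 powBody) ∘
    fanoutFn (nthF 0) (fanoutFn (lenBinF ∘ sndPow 1)
      (fanoutFn (coneFn ∘ fanoutFn (nthF 0) fun _ => encodeNat 0) (fanoutFn (nthF 1) (sndPow 1))))

/-- **`cpowFn ∈ FP`.** [cite: AgrawalKayalSaxena2004, §5 (repeated squaring)] -/
theorem cpowFn_mem_FP : cpowFn ∈ FP :=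
  comp_mem_FP (nthF_mem_FP 2) (comp_mem_FP
    (loopX_mem_FP (clipF_mem_FP 5 powBody_mem_FP) (P := 5 * X + 5) fun z => by
      have := length_clipF_le 5 powBody z; simp only [eval_add, eval_mul, eval_ofNat, eval_X]; omega)
    (fanoutFn_mem_FP (nthF_mem_FP 0) (fanoutFn_mem_FP (comp_mem_FP lenBinF_mem_FP (sndPow_mem_FP 1))
      (fanoutFn_mem_FP (comp_mem_FP coneFn_mem_FP (fanoutFn_mem_FP (nthF_mem_FP 0) (const_mem_FP _)))
        (fanoutFn_mem_FP (nthF_mem_FP 1) (sndPow_mem_FP 1))))))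

/-- **`cpowFn` computes `AKS.cpow`**: for `0 < n`, canonical `u`, padding `|pad| ≥ r (|bin n| + 1)` and
`|bin e| ≤ |ctx|`, `cpowFn ⟨ctx, ⟨natList u, bin e⟩⟩ = natList (cpow n r u e)`. [cite: AgrawalKayalSaxena2004, §5 (repeated squaring)] -/
theorem cpowFn_apply (pad : List Bool) {n r : ℕ} (hn : 0 < n) (hpad : r * ((encodeNat n).length + 1) ≤ pad.length)
    {u : List ℕ} (hu : AKS.Canon n r u) {e : ℕ} (he : (encodeNat e).length ≤ (pctx pad n r).length) :
    cpowFn (boolPair (pctx pad n r) (boolPair (natList u) (encodeNat e))) = natList (AKS.cpow n r u e) := by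
  have hr : r ≤ (pctx pad n r).length := by rw [length_pctx]; nlinarith
  have hinit : fanoutFn (nthF 0) (fanoutFn (lenBinF ∘ sndPow 1)
      (fanoutFn (coneFn ∘ fanoutFn (nthF 0) fun _ => encodeNat 0) (fanoutFn (nthF 1) (sndPow 1))))
      (boolPair (pctx pad n r) (boolPair (natList u) (encodeNat e))) =
      boolPair (pctx pad n r) (boolPair (encodeNat e.size) (pstate (AKS.cone n r) u e)) := by
    simp only [fanoutFn_apply, nthF_zero_boolPair, nthF_succ_boolPair, Function.comp_apply, sndPow_succ_boolPair,
      sndPow_zero, sndF_boolPair, lenBinF_apply, TM2Pass.length_encodeNat_eq_size, pstate, coneFn_apply pad hn hr]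
  rw [cpowFn, Function.comp_apply, Function.comp_apply, hinit,
    loopX_apply _ _ _ (by rw [← TM2Pass.length_encodeNat_eq_size]; exact he),
    loopModel_powBody pad hn hpad _ _ (AKS.canon_cone hn r) hu he]
  simp [pstate, AKS.cpow]

/-! ### The test of step 5 -/

/-- **The congruence test for one `a`**: `⟨ctx, bin a⟩ ↦ [natList (cpow n r (xPlusA n r a) n) = natList (xnPlusA n r a)]`.
[cite: AgrawalKayalSaxena2004, §4 (step 5)] -/
noncomputable def congrFn : List Bool → List Bool :=
  eqPairFn ∘ fanoutFn (cpowFn ∘ fanoutFn fstF (fanoutFn xPlusAFn (cN ∘ fstF))) xnPlusAFn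

/-- **`congrFn ∈ FP`.** [cite: AgrawalKayalSaxena2004, §5 (proof of Thm 5.1)] -/
theorem congrFn_mem_FP : congrFn ∈ FP :=
  comp_mem_FP eqPairFn_mem_FP (fanoutFn_mem_FP
    (comp_mem_FP cpowFn_mem_FP (fanoutFn_mem_FP fstF_mem_FP (fanoutFn_mem_FP xPlusAFn_mem_FP (comp_mem_FP cN_mem_FP fstF_mem_FP))))
    xnPlusAFn_mem_FP)

/-- `congrFn` is one-bit on every input. [folklore] -/
theorem oneBit_congrFn : OneBit congrFn := fun w => by
  rw [congrFn, Function.comp_apply, fanoutFn_apply, eqPairFn_boolPair]; exact ⟨_, rfl⟩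

/-- **`congrFn` decides step 5** [AKS04]: for `0 < n` (the test itself needs `2 ≤ n`, `2 ≤ r` to mean the
congruence, `AKS.congrTest_eq_true_iff`) and padding `|pad| ≥ r (|bin n| + 1)`,
`congrFn ⟨ctx, bin a⟩ = [AKS.congrTest n r a]`. [cite: AgrawalKayalSaxena2004, §4 (step 5)] -/
theorem congrFn_apply (pad : List Bool) {n r : ℕ} (hn : 0 < n) (hpad : r * ((encodeNat n).length + 1) ≤ pad.length) (a : ℕ) :
    congrFn (boolPair (pctx pad n r) (encodeNat a)) = [AKS.congrTest n r a] := by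
  have hr : r ≤ (pctx pad n r).length := by rw [length_pctx]; nlinarith
  have hne : (encodeNat n).length ≤ (pctx pad n r).length := by rw [length_pctx]; omega
  simp only [congrFn, Function.comp_apply, fanoutFn_apply, fstF_boolPair, cN_pctx, xPlusAFn_apply pad hn hr,
    xnPlusAFn_apply pad hn hr]
  rw [cpowFn_apply pad hn hpad (AKS.canon_xPlusA hn r a) hne, eqPairFn_boolPair, AKS.congrTest]
  by_cases h : AKS.cpow n r (AKS.xPlusA n r a) n = AKS.xnPlusA n r a
  · simp [h]
  · have : natList (AKS.cpow n r (AKS.xPlusA n r a) n) ≠ natList (AKS.xnPlusA n r a) := fun h' => h (natList_injective h')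
    simp [h, this]

end AKSMachine

end Literature.Computability.QuantumComplexity
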